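import Literature.NumberTheory.Transcendental.KZProductIdeal
import HarnessLib
import HarnessLib.Audit

/-!
# SoloInformed — the equidimensional relations and flattening (Newton–Leibniz elimination, file 1)

Solo programme `solo-KontsevichZagierPeriods-informed`, session s244, file 583 (K-NF file 1 of the
kernel programme of THEOREM NF, `paper/nl-elimination.md`).

The four moves of the Kontsevich–Zagier calculus (`KZ.relations`) split into the three
*equidimensional* moves (1a) `domainAddRel`, (1b) `integrandAddRel`, (2) `changeOfVariablesRel`
— which relate representations of one and the same dimension — and the single
dimension-changing move (3) `newtonLeibnizRel`.  This file records:

* `soloInformedEquidimRelations` — the subgroup `relations₁₂` generated by the moves (1a), (1b), (2),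
  with `soloInformed_equidimRelations_le_relations`;
* `soloInformedUnitIntervalRep` — the representation `ι = ([0, 1] ⊂ ℝ¹, 1)` (domain `{y | y₀ ∈ [0,1]}`) and
  `soloInformedFlat r = r × ι` (the *flattening* of `r`: one dummy coordinate, appended last);
* **`soloInformed_of_flat_sub_of_mem_newtonLeibnizRel`** — `[r × [0,1]] − [r]` is ONE
  Newton–Leibniz move (primitive `F(x, t) = t · f(x)`, `a = 0`, `b = 1`); hence the *flattening
  span* `soloInformedFlatSpan` (generated by these differences) lies in `relations`
  (`soloInformed_flatSpan_le_relations`), and `relations₁₂ ⊔ flatSpan ≤ relations`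
  (`soloInformed_equidimRelations_sup_flatSpan_le_relations`);
* `SoloInformedNLElimination` — the statement of THEOREM NF ("every Newton–Leibniz move is a
  combination of equidimensional moves and flattenings":
  `newtonLeibnizRel ⊆ relations₁₂ ⊔ flatSpan`), and, granting it,
  **`soloInformed_relations_eq_sup_of_nlElimination : relations = relations₁₂ ⊔ flatSpan`**.

The reverse inclusion `SoloInformedNLElimination` is proved on paper (`paper/nl-elimination.md`, §2:
cells adapted to the primitive, rule (2) with `Φ_C = (x, F(x, t))`, `|det| = |∂ₜF|`, crossing-number
sheet count) from the `C¹` cell decomposition theorem, which the tree holds as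
`Literature.ModelTheory.ExponentialFields` `exists_c1CAD_c1On` [Dries1998, Ch. 7 (3.2)]; its kernel
form is the object of the successor files.  Nothing here is conditional except the last theorem,
whose hypothesis is displayed.

References: M. Kontsevich, D. Zagier, *Periods* (2001), §1.2 rules (1)–(3); J. Commelin,
P. Habegger, A. Huber, *Exponential periods and o-minimality* (flattening as a scissors relation,
cf. [Cluckers–Viu-Sos 2022, (2.6)]); this work (THEOREM NF).
-/

noncomputable section

open scoped BigOperators

namespace Summit.KontsevichZagierPeriods.KontsevichZagierPeriods.Theorems

open Set MeasureTheory MvPolynomial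
open Literature.ModelTheory.ExponentialFields
open Literature.NumberTheory.Transcendental Literature.NumberTheory.Transcendental.KZ

variable {n : ℕ}

/-! ### The equidimensional relations `relations₁₂` -/

/-- **`relations₁₂`**: the subgroup of `FormalRep` generated by the three equidimensional moves
(1a) additivity in the domain, (1b) additivity in the integrand, (2) change of variables.
[Kontsevich–Zagier 2001, §1.2 rules (1), (2); this work, THEOREM NF] -/
def soloInformedEquidimRelations : AddSubgroup FormalRep :=
  AddSubgroup.closure (domainAddRel ∪ integrandAddRel ∪ changeOfVariablesRel)

/-- `relations₁₂ ≤ relations`. [Kontsevich–Zagier 2001, §1.2] -/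
theorem soloInformed_equidimRelations_le_relations : soloInformedEquidimRelations ≤ relations := by
  unfold soloInformedEquidimRelations relations
  exact AddSubgroup.closure_mono subset_union_left

/-- Each equidimensional move lies in `relations₁₂`. [Kontsevich–Zagier 2001, §1.2] -/
theorem soloInformed_domainAddRel_subset_equidimRelations :
    domainAddRel ⊆ (soloInformedEquidimRelations : Set FormalRep) := fun _ hc =>
  AddSubgroup.subset_closure (Or.inl (Or.inl hc))

/-- Each equidimensional move lies in `relations₁₂`. [Kontsevich–Zagier 2001, §1.2] -/
theorem soloInformed_integrandAddRel_subset_equidimRelations :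
    integrandAddRel ⊆ (soloInformedEquidimRelations : Set FormalRep) := fun _ hc =>
  AddSubgroup.subset_closure (Or.inl (Or.inr hc))

/-- Each equidimensional move lies in `relations₁₂`. [Kontsevich–Zagier 2001, §1.2] -/
theorem soloInformed_changeOfVariablesRel_subset_equidimRelations :
    changeOfVariablesRel ⊆ (soloInformedEquidimRelations : Set FormalRep) := fun _ hc =>
  AddSubgroup.subset_closure (Or.inr hc)

/-! ### The unit interval and flattening -/

/-- The closed unit interval `{y | y₀ ∈ [0, 1]} ⊂ ℝ¹` lies in the order box `Icc 0 1` (finite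
volume). [folklore] -/
theorem soloInformed_unitInterval_subset_Icc :
    {y : Fin 1 → ℝ | y 0 ∈ Icc (0 : ℝ) 1} ⊆ Icc (0 : Fin 1 → ℝ) 1 := by
  intro y hy
  refine ⟨fun i => ?_, fun i => ?_⟩
  · rw [Fin.fin_one_eq_zero i]; exact hy.1
  · rw [Fin.fin_one_eq_zero i]; exact hy.2

/-- **`ι = ([0, 1], 1)`**: the unit interval with integrand `1`, a representation of the number `1`
in dimension `1` (domain `{y | y₀ ∈ [0, 1]}`, cut out by the two polynomial inequalities
`0 ≤ X₀`, `X₀ ≤ 1` over `ℚ` [BCR 1998, §2.1]). [Kontsevich–Zagier 2001, §1.1] -/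
def soloInformedUnitIntervalRep : IntegralRep 1 where
  domain := {y : Fin 1 → ℝ | y 0 ∈ Icc (0 : ℝ) 1}
  integrand := fun _ => 1
  isSemialgebraic_domain := by
    have hset : {y : Fin 1 → ℝ | y 0 ∈ Icc (0 : ℝ) 1} =
        {y : Fin 1 → ℝ | aeval y (C 0 : MvPolynomial (Fin 1) ℚ) ≤
            aeval y (X 0 : MvPolynomial (Fin 1) ℚ)} ∩
          {y : Fin 1 → ℝ | aeval y (X 0 : MvPolynomial (Fin 1) ℚ) ≤
            aeval y (C 1 : MvPolynomial (Fin 1) ℚ)} := by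
      ext y
      simp
    rw [hset]
    exact (isSemialgebraic_setOf_eval_le _ _).inter (isSemialgebraic_setOf_eval_le _ _)
  isSemialgebraicFunOn_integrand := by
    have hdom : IsSemialgebraic ℚ {y : Fin 1 → ℝ | y 0 ∈ Icc (0 : ℝ) 1} := by
      have hset : {y : Fin 1 → ℝ | y 0 ∈ Icc (0 : ℝ) 1} =
          {y : Fin 1 → ℝ | aeval y (C 0 : MvPolynomial (Fin 1) ℚ) ≤
              aeval y (X 0 : MvPolynomial (Fin 1) ℚ)} ∩
            {y : Fin 1 → ℝ | aeval y (X 0 : MvPolynomial (Fin 1) ℚ) ≤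
              aeval y (C 1 : MvPolynomial (Fin 1) ℚ)} := by
        ext y
        simp
      rw [hset]
      exact (isSemialgebraic_setOf_eval_le _ _).inter (isSemialgebraic_setOf_eval_le _ _)
    simpa using isSemialgebraicFunOn_aeval (R := ℝ) hdom (1 : MvPolynomial (Fin 1) ℚ)
  integrableOn :=
    integrableOn_const
      ((measure_mono soloInformed_unitInterval_subset_Icc).trans_lt measure_Icc_lt_top).ne

/-- The domain of `ι`. -/
@[simp] theorem soloInformed_unitIntervalRep_domain :
    soloInformedUnitIntervalRep.domain = {y : Fin 1 → ℝ | y 0 ∈ Icc (0 : ℝ) 1} := rfl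

/-- The integrand of `ι` is `1`. -/
@[simp] theorem soloInformed_unitIntervalRep_integrand (y : Fin 1 → ℝ) :
    soloInformedUnitIntervalRep.integrand y = 1 := rfl

/-- **Flattening** `r ↦ r × [0, 1]`: one dummy coordinate appended LAST, integrand `f ∘ init`.
[Cluckers–Viu-Sos 2022, (2.6) (scissors form); this work, THEOREM NF] -/
def soloInformedFlat (r : IntegralRep n) : IntegralRep (n + 1) :=
  r.prod soloInformedUnitIntervalRep

/-- `[r] * [ι] = [flat r]` in the ring `FormalRep`. [Kontsevich–Zagier 2001, §4.1] -/
theorem soloInformed_of_mul_of_unitIntervalRep (r : IntegralRep n) :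
    of r * of soloInformedUnitIntervalRep = of (soloInformedFlat r) :=
  of_mul_of r _

/-- The last coordinate of the trailing `Fin 1`-block is the last coordinate. [folklore] -/
theorem soloInformed_natAdd_zero_eq_last : (Fin.natAdd n (0 : Fin 1)) = Fin.last n :=
  Fin.ext (by simp)

/-- The domain of `flat r` is the band `{z | init z ∈ σ, 0 ≤ z_last ≤ 1}`. [this work] -/
theorem soloInformed_flat_domain (r : IntegralRep n) :
    (soloInformedFlat r).domain =
      {z | (Fin.init z : Fin n → ℝ) ∈ r.domain ∧ (0 : ℝ) ≤ z (Fin.last n) ∧ z (Fin.last n) ≤ 1} := by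
  ext z
  simp only [soloInformedFlat, IntegralRep.prod_domain, IntegralRep.mem_prodDomain,
    soloInformed_unitIntervalRep_domain, mem_setOf_eq, mem_Icc, soloInformed_natAdd_zero_eq_last]
  exact Iff.rfl

/-- The leading block of `Fin.snoc x t` is `x`. [folklore] -/
theorem soloInformed_snoc_castAdd_one (x : Fin n → ℝ) (t : ℝ) :
    (fun i => (Fin.snoc x t : Fin (n + 1) → ℝ) (Fin.castAdd 1 i)) = x :=
  funext fun i => Fin.snoc_castSucc (α := fun _ : Fin (n + 1) => ℝ) (p := x) (x := t) (i := i)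

/-- The integrand of `flat r` at `(x, t)` is `f x`. [this work] -/
theorem soloInformed_flat_integrand_snoc (r : IntegralRep n) (x : Fin n → ℝ) (t : ℝ) :
    (soloInformedFlat r).integrand (Fin.snoc x t) = r.integrand x := by
  rw [soloInformedFlat, IntegralRep.prod_integrand_eq, IntegralRep.prodFun_apply,
    soloInformed_snoc_castAdd_one, soloInformed_unitIntervalRep_integrand, mul_one]

/-- **Flattening is ONE Newton–Leibniz move**: `[r × [0,1]] − [r] ∈ newtonLeibnizRel`, with base
`r`, `a = 0`, `b = 1` and primitive `F(x, t) = t · f(x)` (`∂ₜF = f ∘ init` = the integrand of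
`r × [0,1]`, `F(x,1) − F(x,0) = f(x)`). [Kontsevich–Zagier 2001, §1.2 rule (3); this work] -/
theorem soloInformed_of_flat_sub_of_mem_newtonLeibnizRel (r : IntegralRep n) :
    of (soloInformedFlat r) - of r ∈ newtonLeibnizRel := by
  set F : (Fin (n + 1) → ℝ) → ℝ :=
    fun z => z (Fin.last n) * r.integrand (fun i => z (Fin.castAdd 1 i)) with hF
  have hF_snoc : ∀ (x : Fin n → ℝ) (t : ℝ), F (Fin.snoc x t) = t * r.integrand x := by
    intro x t
    simp only [hF, soloInformed_snoc_castAdd_one, Fin.snoc_last]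
  -- semialgebraicity of the primitive on the band (product of two semialgebraic functions)
  have hdomF : IsSemialgebraicFunOn ℚ (soloInformedFlat r).domain F := by
    have h₁ : IsSemialgebraicFunOn ℚ (soloInformedFlat r).domain (fun z => z (Fin.last n)) := by
      simpa using isSemialgebraicFunOn_aeval (R := ℝ) (soloInformedFlat r).isSemialgebraic_domain
        (X (Fin.last n) : MvPolynomial (Fin (n + 1)) ℚ)
    have h₂ : IsSemialgebraicFunOn ℚ (soloInformedFlat r).domain
        (fun z => r.integrand (fun i => z (Fin.castAdd 1 i))) :=
      isSemialgebraicFunOn_cylinder_left r.isSemialgebraic_domain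
        soloInformedUnitIntervalRep.isSemialgebraic_domain r.isSemialgebraicFunOn_integrand
    exact IsSemialgebraicFunOn.mul_holds h₁ h₂
  have h0 : IsSemialgebraicFunOn ℚ r.domain (fun _ : Fin n → ℝ => (0 : ℝ)) := by
    simpa using isSemialgebraicFunOn_aeval (R := ℝ) r.isSemialgebraic_domain
      (0 : MvPolynomial (Fin n) ℚ)
  have h1 : IsSemialgebraicFunOn ℚ r.domain (fun _ : Fin n → ℝ => (1 : ℝ)) := by
    simpa using isSemialgebraicFunOn_aeval (R := ℝ) r.isSemialgebraic_domain
      (1 : MvPolynomial (Fin n) ℚ)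
  refine ⟨n, soloInformedFlat r, r, fun _ => 0, fun _ => 1, F, hdomF, h0, h1,
    fun _ _ => zero_le_one, soloInformed_flat_domain r, ?_, ?_, ?_, rfl⟩
  · -- continuity of `t ↦ F(x, t) = t · f(x)` on `[0, 1]`
    intro x _
    simp only [hF_snoc]
    exact (continuousOn_id.mul continuousOn_const)
  · -- `∂ₜ F(x, t) = f(x)` = the integrand of `flat r` at `(x, t)`
    intro x _ t _
    simp only [hF_snoc, soloInformed_flat_integrand_snoc]
    simpa using (hasDerivAt_id t).mul_const (r.integrand x)
  · -- boundary term: `F(x, 1) − F(x, 0) = f(x)`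
    intro x _
    simp only [hF_snoc, one_mul, zero_mul, sub_zero]

/-- Flattening is a relation: `r × [0,1] ∼ r`. [Kontsevich–Zagier 2001, §1.2 rule (3)] -/
theorem soloInformed_equivalent_flat (r : IntegralRep n) : Equivalent (soloInformedFlat r) r :=
  newtonLeibnizRel_subset_relations (soloInformed_of_flat_sub_of_mem_newtonLeibnizRel r)

/-- The value is unchanged by flattening. [Kontsevich–Zagier 2001, §1.2] -/
theorem soloInformed_value_flat (r : IntegralRep n) : (soloInformedFlat r).value = r.value :=
  Equivalent.value_eq_holds (soloInformed_equivalent_flat r)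

/-! ### The flattening span and the statement of THEOREM NF -/

/-- **The flattening span** `U`: the subgroup generated by the differences `[r × [0,1]] − [r]`.
[this work, THEOREM NF] -/
def soloInformedFlatSpan : AddSubgroup FormalRep :=
  AddSubgroup.closure {c | ∃ (n : ℕ) (r : IntegralRep n), c = of (soloInformedFlat r) - of r}

/-- The generators of the flattening span are Newton–Leibniz moves. [this work] -/
theorem soloInformed_flatGenerators_subset_newtonLeibnizRel :
    {c | ∃ (n : ℕ) (r : IntegralRep n), c = of (soloInformedFlat r) - of r} ⊆ newtonLeibnizRel := by
  rintro c ⟨n, r, rfl⟩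
  exact soloInformed_of_flat_sub_of_mem_newtonLeibnizRel r

/-- `U ≤ relations`. [this work] -/
theorem soloInformed_flatSpan_le_relations : soloInformedFlatSpan ≤ relations :=
  (AddSubgroup.closure_le _).2 fun _ hc =>
    newtonLeibnizRel_subset_relations (soloInformed_flatGenerators_subset_newtonLeibnizRel hc)

/-- `relations₁₂ ⊔ U ≤ relations` (the unconditional half of THEOREM NF). [this work] -/
theorem soloInformed_equidimRelations_sup_flatSpan_le_relations :
    soloInformedEquidimRelations ⊔ soloInformedFlatSpan ≤ relations :=
  sup_le soloInformed_equidimRelations_le_relations soloInformed_flatSpan_le_relations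

/-- **THEOREM NF (Newton–Leibniz elimination), as a statement**: every Newton–Leibniz move is a
`ℤ`-combination of equidimensional moves and flattening differences,
`newtonLeibnizRel ⊆ relations₁₂ ⊔ U`.  Proved on paper from the `C¹` cell decomposition theorem
(`exists_c1CAD_c1On`), the change of variables `Φ_C(x, t) = (x, F(x, t))` on the cells where
`∂ₜF ≠ 0` (`|det DΦ_C| = |∂ₜF|`), Sard for the cells where `∂ₜF = 0`, and the crossing-number count
of the sheets; kernel form in the successor files. [this work, THEOREM NF] -/
def SoloInformedNLElimination : Prop :=
  newtonLeibnizRel ⊆ ((soloInformedEquidimRelations ⊔ soloInformedFlatSpan : AddSubgroup FormalRep) :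
    Set FormalRep)

/-- **`relations = relations₁₂ ⊔ U`**, granting `SoloInformedNLElimination`: the KZ relations are
the equidimensional relations plus flattening.  [this work, THEOREM NF] -/
theorem soloInformed_relations_eq_sup_of_nlElimination (h : SoloInformedNLElimination) :
    relations = soloInformedEquidimRelations ⊔ soloInformedFlatSpan := by
  refine le_antisymm ?_ soloInformed_equidimRelations_sup_flatSpan_le_relations
  unfold relations
  refine (AddSubgroup.closure_le _).2 fun c hc => ?_
  rcases hc with hc | hc
  · exact AddSubgroup.mem_sup_left (AddSubgroup.subset_closure hc)
  · exact h hc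

/-- Granting `SoloInformedNLElimination`, two representations are KZ-equivalent iff
`[r] − [r'] ∈ relations₁₂ ⊔ U`. [this work, THEOREM NF] -/
theorem soloInformed_equivalent_iff_of_nlElimination (h : SoloInformedNLElimination) {m : ℕ}
    (r : IntegralRep n) (r' : IntegralRep m) :
    Equivalent r r' ↔ of r - of r' ∈ soloInformedEquidimRelations ⊔ soloInformedFlatSpan := by
  rw [Equivalent, soloInformed_relations_eq_sup_of_nlElimination h]

end Summit.KontsevichZagierPeriods.KontsevichZagierPeriods.Theorems
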